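import Summits.QuantumAdvantage.QuantumAdvantage.Theses.CentralFactorial
import Literature.NumberTheory.QuadraticFields.ChowlaCentralFactorialProofs

/-!
# Route `CentralFactorial`, support `ChowlaSignLaw` (stmt-QuantumAdvantage-10309)

Kiselev 1948 / Chowla 1961 / Mordell 1961: for `p ≡ 1 (mod 4)` prime, `K` quadratic of discriminant `p` with class
number `h`, and `(t, u)` the least positive solution of `t² + 4 = p u²`: `p ∣ 2·((p−1)/2)! − (−1)^{(h+1)/2}·t`.
The route item is, verbatim, the Literature fact
`Literature.NumberTheory.QuadraticFields.chowla_central_factorial_congruence` (ChowlaCentralFactorial.lean), which is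
PROVED in the tree (`chowla_central_factorial_congruence_holds`, ChowlaCentralFactorialProofs.lean: Dirichlet's class
number formula in the form `√p · ε^h = ∏ (1 − ζ_p^n)` reduced modulo `(1 − ζ_p)`). This file closes the item by that theorem.

HONEST FRAMING: a closed ledger item, NOT summit progress.

References: S. Chowla, Proc. Nat. Acad. Sci. USA 47 (1961) 878 [Chowla1961]; L. J. Mordell, Amer. Math. Monthly 68 (1961)
145–146 [Mordell1961]; M. J. Jacobson, H. C. Williams, *Solving the Pell Equation* (2008), §9.2 [JacobsonWilliams2008].
-/

set_option linter.dupNamespace false -- D-0017: single-problem summit ⇒ `QuantumAdvantage.QuantumAdvantage` by design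

namespace Summit.QuantumAdvantage.QuantumAdvantage.Theorems.ChowlaSignLaw

/-- **`ChowlaSignLaw`** (stmt-QuantumAdvantage-10309), by the tree's proof of Chowla's central-factorial congruence.
[cite: Chowla1961, Theorem] [cite: Mordell1961] -/
theorem chowlaSignLaw_proof :
    Summit.QuantumAdvantage.QuantumAdvantage.Theses.CentralFactorial.ChowlaSignLaw := by
  unfold Summit.QuantumAdvantage.QuantumAdvantage.Theses.CentralFactorial.ChowlaSignLaw
  exact Literature.NumberTheory.QuadraticFields.chowla_central_factorial_congruence_holds

end Summit.QuantumAdvantage.QuantumAdvantage.Theorems.ChowlaSignLaw
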